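import Literature.MathematicalPhysics.QuantumLattice.JostPoints
import Literature.MathematicalPhysics.QuantumLattice.WightmanAnalyticContinuation
import HarnessLib

/-!
# Real anchors for the permuted tubes: a dichotomy in the proper complex Lorentz group

Topic `Literature/MathematicalPhysics/QuantumLattice` (trunk T-AQFT). Pure geometry of the relative
forward tube `𝒯ʳₙ` (`Im (z_k − z_{k−1}) ∈ V₊`) and the proper complex Lorentz group `L₊(ℂ)`, in the
decomposition of the named fact `IsWightmanQFT.extendedTube_continuation_perm_eq` ((K): the
Bargmann–Hall–Wightman continuation of the Wightman functions of one scalar field is consistent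
under permutations on `𝒯'ₙ ∩ σ𝒯'ₙ`, `𝒯'ₙ = ⋃_{Λ ∈ L₊(ℂ)} Λ𝒯ʳₙ`; Streater–Wightman (1964) Thm. 3-6,
Osterwalder–Schrader I §5 p. 97 citing Jost (1965) p. 83).

By `L₊(ℂ)`-invariance, (K) is the statement `𝔚(w ∘ σ) = 𝔚(w)` for the points `w ∈ 𝒯ʳₙ` with
`M(w ∘ σ) ∈ 𝒯ʳₙ` for some `M ∈ L₊(ℂ)`. The printed argument (S–W Thm. 3-6: agreement near the real
Jost points common to both tubes, then analytic continuation) needs every connected component of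
`𝒯'ₙ ∩ σ𝒯'ₙ` to reach such a real point, a statement proved in print only in four dimensions
(Tomozawa; used in `WightmanPermutedTubeDim4Proofs`) and false in `1 + 1` dimensions. This file
supplies the geometric half of a dimension-independent route: it is enough that the *permuted*
real point be a Jost point (the comparison with `𝔚` on the tube side is then made through the
uniqueness of distributional boundary values, `WightmanPermutedTubeAnchor`), and such one-sided
anchors are always available after changing the Lorentz transformation `M`:

* `PermAnchor.exists_anchor` (**main result**, space dimension `d ≥ 1`): if `σ ≠ 1`, `w ∈ 𝒯ʳₙ`,
  `M ∈ L₊(ℂ)` and `M(w ∘ σ) ∈ 𝒯ʳₙ`, then there is `M' ∈ L₊(ℂ)` with `M'(w ∘ σ) ∈ 𝒯ʳₙ` **and** a real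
  vector `r` with `Im (M' r) ∈ V₊` — so that `M'⁻¹𝒯ʳₙ` contains the real configurations
  `(k r)_k ∘ σ⁻¹ ∘ σ`, next to which the convex set `{w̃ ∈ 𝒯ʳₙ | M'(w̃ ∘ σ) ∈ 𝒯ʳₙ} ∋ w` accumulates.

The proof is a trichotomy on the real kernel of `v ↦ Im (M v)` (`v` real):
* if it contains a space-like `v`, then `a = M v` is real and space-like, and composing `M` with a
  small imaginary boost `B_{it}` in the plane `(e₀, â)` (`planeBoost`, S–W (2-91)) gives
  `Im (B_{it} M v) = sin t (‖a⃗‖ e₀ + a⁰ â) ∈ V₊` while keeping `M(w ∘ σ)` in the open tube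
  (`PermAnchor.exists_anchor_of_spacelike_ker`);
* if it is non-zero but contains no space-like vector, pick `v₀ ≠ 0` in it: `a = M v₀` is real,
  causal and non-zero, and `η_ℂ(M v₀, M ζ) = η_ℂ(v₀, ζ)` gives `η(a, Im M ζ) = η(v₀, Im ζ)`; applied to
  the successive differences of `w ∘ σ` (whose images under `M` have imaginary parts in `V₊`) and
  of `w`, the numbers `η(v₀, Im w_i)` are strictly monotone both in `i` and in `σ(i)`, forcing
  `σ = 1` or `σ = rev` (`PermAnchor.perm_eq_one_or_rev`); and for `σ = rev` the reflection
  `B_{iπ} = diag(−1, −1, 1, …, 1)` maps `w ∘ rev` into `𝒯ʳₙ` for *every* `w ∈ 𝒯ʳₙ`, with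
  `Im (B_{i(π − t)} e₁) = sin t · e₀ ∈ V₊` (`PermAnchor.exists_anchor_rev`);
* if it is zero, `v ↦ Im (M v)` is onto and `M` itself will do.

No field theory enters; the analytic use is in `WightmanPermutedTubeAnchor` / `WightmanPermutedTubeHolds`.

## References

* R. F. Streater, A. S. Wightman, *PCT, Spin and Statistics, and All That* (1964), §2-4
  (eq. (2-91), Thm. 2-12), Thm. 3-6. [StreaterWightman1964]
* K. Osterwalder, R. Schrader, Comm. Math. Phys. 31 (1973), §5 p. 97. [OsterwalderSchraderCMP1973]

## Mathlib / tree

Used: `StrictMono.range_inj` (a strictly monotone permutation of `Fin n` is the identity),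
`Fin.strictMono_iff_lt_succ`, `Fin.strictAnti_iff_succ_lt`, `LinearMap.injective_iff_surjective`,
`real_inner_le_norm`; from the tree `planeBoost`, `planeBoostEquiv_mem_properComplexLorentzGroup`,
`imPart_planeBoost_complexifyPoint` (`JostPoints`), `isOpen_relForwardTube`,
`complexifyPoint_rePart_add_imPart` (`WightmanAnalyticContinuation`), `mem_relForwardTube_succ_iff`,
`mem_forwardCone_of_isTimelike_of_minkowskiForm_pos`, `minkowskiForm_pos_of_mem_forwardCone`.
-/

noncomputable section

open Complex Set Filter
open _root_.Topology
open Literature.MathematicalPhysics.QuantumFieldTheory (complexifyPoint_add complexifyPoint_smul)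

namespace Literature.MathematicalPhysics.QuantumLattice

namespace PermAnchor

variable {d n : ℕ}

/-! ### Elementary algebra of real and complex points -/

/-- `complexifyPoint` is injective. [folklore] -/
theorem complexifyPoint_injective : Function.Injective (complexifyPoint : SpaceTime d → Fin (d + 1) → ℂ) := by
  intro a b h
  have := congrArg rePart h
  simpa using this

/-- A complex point with vanishing imaginary part is the real point of its real part. [folklore] -/
theorem eq_complexifyPoint_rePart {u : Fin (d + 1) → ℂ} (hu : imPart u = 0) :
    u = complexifyPoint (rePart u) := by
  conv_lhs => rw [← complexifyPoint_rePart_add_imPart u]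
  rw [hu]
  funext μ; simp

/-- Imaginary part of `η_ℂ(a, u)` for a real vector `a`: `Im η_ℂ(a, u) = η(a, Im u)`. [folklore] -/
theorem im_complexMinkowskiForm_complexifyPoint (a : SpaceTime d) (u : Fin (d + 1) → ℂ) :
    (complexMinkowskiForm d (complexifyPoint a) u).im = minkowskiForm d a (imPart u) := by
  simp [complexMinkowskiForm_apply, minkowskiForm_apply, Complex.im_sum]

/-- Imaginary part of a real multiple of a complex vector. [folklore] -/
theorem imPart_real_smul (c : ℝ) (z : Fin (d + 1) → ℂ) : imPart ((c : ℂ) • z) = c • imPart z := by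
  ext μ; simp

/-- Imaginary part of `I • a` for a real vector `a`. [folklore] -/
theorem imPart_I_smul_complexifyPoint (a : SpaceTime d) : imPart ((I : ℂ) • complexifyPoint a) = a := by
  ext μ; simp

/-! ### Causal vectors pair with a definite sign against the forward cone -/

/-- A non-zero vector of non-negative Minkowski square has non-zero time component. [folklore] -/
theorem apply_zero_ne_zero_of_causal {a : SpaceTime d} (ha : a ≠ 0) (haa : 0 ≤ minkowskiForm d a a) :
    a 0 ≠ 0 := by
  intro h0
  rw [minkowskiForm_self, h0] at haa
  have hn : ‖spaceC d a‖ = 0 := by nlinarith [norm_nonneg (spaceC d a)]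
  apply ha
  have hsp : spaceC d a = 0 := norm_eq_zero.1 hn
  rw [← ofTimeSpace_apply_zero_spaceC a, h0, hsp]
  ext μ
  refine Fin.cases ?_ (fun i => ?_) μ
  · simp [ofTimeSpace_apply_zero]
  · simp [ofTimeSpace_apply_succ]

/-- **Reverse Cauchy–Schwarz for a causal vector**: if `a⁰ > 0` and `η(a,a) ≥ 0` then
`η(a, q) > 0` for every `q ∈ V₊`. [folklore] -/
theorem minkowskiForm_pos_of_causal {a q : SpaceTime d} (ha0 : 0 < a 0)
    (haa : 0 ≤ minkowskiForm d a a) (hq : q ∈ forwardCone d) : 0 < minkowskiForm d a q := by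
  rw [mem_forwardCone_iff_norm_lt] at hq
  rw [minkowskiForm_self] at haa
  have ha : ‖spaceC d a‖ ≤ a 0 := by
    by_contra h
    push Not at h
    nlinarith [norm_nonneg (spaceC d a)]
  have hq0 : 0 < q 0 := (norm_nonneg _).trans_lt hq
  rw [minkowskiForm_eq_inner, sub_pos]
  calc inner ℝ (spaceC d a) (spaceC d q) ≤ ‖spaceC d a‖ * ‖spaceC d q‖ := real_inner_le_norm _ _
    _ ≤ a 0 * ‖spaceC d q‖ := by gcongr
    _ < a 0 * q 0 := by gcongr

/-- For a non-zero causal `a` the sign of `η(a, q)`, `q ∈ V₊`, is that of `a⁰`: either all these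
pairings are positive or all are negative. [folklore] -/
theorem sign_dichotomy_of_causal {a : SpaceTime d} (ha : a ≠ 0) (haa : 0 ≤ minkowskiForm d a a) :
    (∀ q ∈ forwardCone d, 0 < minkowskiForm d a q) ∨ (∀ q ∈ forwardCone d, minkowskiForm d a q < 0) := by
  rcases lt_or_gt_of_ne (apply_zero_ne_zero_of_causal ha haa) with h | h
  · right
    intro q hq
    have hn0 : 0 < (-a) 0 := by simpa using h
    have hnn : 0 ≤ minkowskiForm d (-a) (-a) := by simpa using haa
    have := minkowskiForm_pos_of_causal hn0 hnn hq
    rw [map_neg, _root_.neg_apply] at this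
    linarith
  · exact Or.inl fun q hq => minkowskiForm_pos_of_causal h haa hq

/-! ### Strictly monotone relabellings are trivial -/

/-- A strictly monotone permutation of `Fin n` is the identity. [folklore] -/
theorem perm_eq_one_of_strictMono {σ : Equiv.Perm (Fin n)} (hσ : StrictMono σ) : σ = 1 := by
  have h : (σ : Fin n → Fin n) = id :=
    (hσ.range_inj strictMono_id).1 (by rw [σ.surjective.range_eq, Set.range_id])
  ext i
  exact congrArg Fin.val (congrFun h i)

/-- A strictly antitone permutation of `Fin n` is the reversal. [folklore] -/
theorem perm_eq_rev_of_strictAnti {σ : Equiv.Perm (Fin n)} (hσ : StrictAnti σ) : σ = Fin.revPerm := by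
  set ρ : Equiv.Perm (Fin n) := Fin.revPerm with hρ
  have hm : StrictMono ⇑(σ * ρ) := by
    intro i j hij
    show σ (Fin.rev i) < σ (Fin.rev j)
    exact hσ (Fin.rev_lt_rev.2 hij)
  have h1 := perm_eq_one_of_strictMono hm
  have hρρ : ρ * ρ = 1 := by
    ext i
    simp [hρ, Equiv.Perm.mul_apply]
  calc σ = σ * ρ * ρ := by rw [mul_assoc, hρρ, mul_one]
    _ = ρ := by rw [h1, one_mul]

/-- **If a real sequence is strictly monotone both along `i` and along `σ(i)`, then `σ` is the
identity or the reversal.** [folklore] -/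
theorem perm_eq_one_or_rev {h : Fin n → ℝ} {σ : Equiv.Perm (Fin n)}
    (hh : StrictMono h ∨ StrictAnti h) (hσ : StrictMono (h ∘ σ) ∨ StrictAnti (h ∘ σ)) :
    σ = 1 ∨ σ = Fin.revPerm := by
  rcases hh with hh | hh <;> rcases hσ with hσ | hσ
  · exact Or.inl (perm_eq_one_of_strictMono fun i j hij => hh.lt_iff_lt.1 (hσ hij))
  · exact Or.inr (perm_eq_rev_of_strictAnti fun i j hij => hh.lt_iff_lt.1 (hσ hij))
  · exact Or.inr (perm_eq_rev_of_strictAnti fun i j hij => hh.lt_iff_gt.1 (hσ hij))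
  · exact Or.inl (perm_eq_one_of_strictMono fun i j hij => hh.lt_iff_gt.1 (hσ hij))

/-! ### The imaginary boosts of a Lorentzian 2-frame -/

section Frame

variable {e s : SpaceTime d}

/-- Real part of `η_ℂ(a, u)` for a real vector `a`: `Re η_ℂ(a, u) = η(a, Re u)`. [folklore] -/
theorem re_complexMinkowskiForm_complexifyPoint (a : SpaceTime d) (u : Fin (d + 1) → ℂ) :
    (complexMinkowskiForm d (complexifyPoint a) u).re = minkowskiForm d a (rePart u) := by
  simp [complexMinkowskiForm_apply, minkowskiForm_apply, Complex.re_sum]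

/-- `w ↦ B_w z` is continuous (entire, in fact). [folklore] -/
theorem continuous_planeBoost_left (e s : SpaceTime d) (z : Fin (d + 1) → ℂ) :
    Continuous fun w : ℂ => planeBoost e s w z := by
  simp only [planeBoost_apply]
  fun_prop

/-- `α ↦ (B_{iα} ζ_k)_k` is continuous on configurations. [folklore] -/
theorem continuous_planeBoost_config (e s : SpaceTime d) (ζ : Fin n → Fin (d + 1) → ℂ) :
    Continuous fun α : ℝ => fun k => planeBoost e s ((α : ℂ) * I) (ζ k) :=
  continuous_pi fun k =>
    (continuous_planeBoost_left e s (ζ k)).comp (continuous_ofReal.mul continuous_const)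

/-- **Imaginary part of the imaginary boost of a complex vector**:
`Im (B_{iα} z) = Im z + ((cos α − 1) η(e, Im z) − sin α · η(s, Re z)) e
  + (sin α · η(e, Re z) − (cos α − 1) η(s, Im z)) s`. [cite: StreaterWightman1964, §2-4 eq. (2-91)] -/
theorem imPart_planeBoost (α : ℝ) (z : Fin (d + 1) → ℂ) :
    imPart (planeBoost e s ((α : ℂ) * I) z) =
      imPart z + ((Real.cos α - 1) * minkowskiForm d e (imPart z) -
          Real.sin α * minkowskiForm d s (rePart z)) • e +
        (Real.sin α * minkowskiForm d e (rePart z) -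
          (Real.cos α - 1) * minkowskiForm d s (imPart z)) • s := by
  rw [planeBoost_apply, imPart_add, imPart_add, imPart_smul_complexifyPoint,
    imPart_smul_complexifyPoint, Complex.cosh_mul_I, Complex.sinh_mul_I]
  congr 2
  · simp [Complex.mul_im, Complex.sub_im, re_complexMinkowskiForm_complexifyPoint,
      im_complexMinkowskiForm_complexifyPoint, Complex.cos_ofReal_re, Complex.sin_ofReal_re,
      Complex.cos_ofReal_im, Complex.sin_ofReal_im]
  · simp [Complex.mul_im, Complex.sub_im, re_complexMinkowskiForm_complexifyPoint,
      im_complexMinkowskiForm_complexifyPoint, Complex.cos_ofReal_re, Complex.sin_ofReal_re,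
      Complex.cos_ofReal_im, Complex.sin_ofReal_im]

/-- At `α = π` the imaginary boost is the reflection of the plane `(e, s)`; on imaginary parts,
`Im (B_{iπ} z) = Im z − 2η(e, Im z) e + 2η(s, Im z) s`. [folklore] -/
theorem imPart_planeBoost_pi (z : Fin (d + 1) → ℂ) :
    imPart (planeBoost e s ((Real.pi : ℂ) * I) z) =
      imPart z + (-(2 * minkowskiForm d e (imPart z))) • e + (2 * minkowskiForm d s (imPart z)) • s := by
  rw [imPart_planeBoost, Real.cos_pi, Real.sin_pi]
  congr 2 <;> ring

variable (heV : e ∈ forwardCone d) (he : minkowskiForm d e e = 1) (hs : minkowskiForm d s s = -1)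
  (hes : minkowskiForm d e s = 0)
include he hs hes

include heV in
/-- **The reflection `B_{iπ}` reverses the tube**: if `Im ζ ∈ −V₊` then `Im (B_{iπ} ζ) ∈ V₊`
(`B_{iπ} = diag(−1, −1, 1, …, 1)` in coordinates adapted to `(e, s)`). [folklore] -/
theorem imPart_planeBoost_pi_mem_forwardCone {ζ : Fin (d + 1) → ℂ} (hζ : -imPart ζ ∈ forwardCone d) :
    imPart (planeBoost e s ((Real.pi : ℂ) * I) ζ) ∈ forwardCone d := by
  rw [imPart_planeBoost_pi]
  set q : SpaceTime d := -imPart ζ with hq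
  have hiq : imPart ζ = -q := by rw [hq, neg_neg]
  rw [hiq]
  have hse : minkowskiForm d s e = 0 := by rw [minkowskiForm_comm, hes]
  -- the reflected vector `R = −q + 2η(e,q) e − 2η(s,q) s`
  have hR : -q + (-(2 * minkowskiForm d e (-q))) • e + (2 * minkowskiForm d s (-q)) • s =
      -q + (2 * minkowskiForm d e q) • e + (-(2 * minkowskiForm d s q)) • s := by
    simp only [map_neg, mul_neg, neg_neg]
  rw [hR]
  have hform : minkowskiForm d (-q + (2 * minkowskiForm d e q) • e + (-(2 * minkowskiForm d s q)) • s)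
      (-q + (2 * minkowskiForm d e q) • e + (-(2 * minkowskiForm d s q)) • s) = minkowskiForm d q q := by
    simp only [map_add, map_neg, map_smul, _root_.add_apply, _root_.neg_apply, _root_.smul_apply,
      smul_eq_mul, he, hs, hes, hse, minkowskiForm_comm q e, minkowskiForm_comm q s]
    ring
  have htl : IsTimelike (-q + (2 * minkowskiForm d e q) • e + (-(2 * minkowskiForm d s q)) • s) := by
    unfold IsTimelike
    rw [hform]
    exact hζ.2
  have hpos : 0 < minkowskiForm d e (-q + (2 * minkowskiForm d e q) • e + (-(2 * minkowskiForm d s q)) • s) := by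
    simp only [map_add, map_neg, map_smul, smul_eq_mul, he, hes, mul_one, mul_zero, add_zero]
    have := minkowskiForm_pos_of_mem_forwardCone heV hζ
    linarith
  exact mem_forwardCone_of_isTimelike_of_minkowskiForm_pos heV htl hpos

omit he in
include heV in
/-- `Im (B_{iα} s) = sin α · e ∈ V₊` for `sin α > 0`: the imaginary boosts produce real points of
the tube. [folklore] -/
theorem imPart_planeBoost_frame_mem_forwardCone {α : ℝ} (hα : 0 < Real.sin α) :
    imPart (planeBoost e s ((α : ℂ) * I) (complexifyPoint s)) ∈ forwardCone d := by
  rw [imPart_planeBoost_complexifyPoint, hs, hes]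
  simpa using smul_mem_forwardCone heV hα

include heV in
/-- **The reversed tube is reached by the reflection `B_{iπ}`**: for every `w ∈ 𝒯ʳₙ` the reversed
configuration `w ∘ rev` is mapped into `𝒯ʳₙ` by `B_{iπ}` (its successive differences are the
negatives of those of `w`, read backwards). [folklore] -/
theorem planeBoost_pi_rev_mem_relForwardTube {w : Fin n → Fin (d + 1) → ℂ}
    (hw : w ∈ QuantumFieldTheory.relForwardTube d n) :
    (fun k => planeBoost e s ((Real.pi : ℂ) * I) (w (Fin.rev k))) ∈ QuantumFieldTheory.relForwardTube d n := by
  cases n with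
  | zero => exact fun k => k.elim0
  | succ m =>
    rw [mem_relForwardTube_succ_iff] at hw ⊢
    intro j
    rw [← map_sub, Fin.rev_succ, Fin.rev_castSucc]
    refine imPart_planeBoost_pi_mem_forwardCone heV he hs hes ?_
    rw [imPart_sub, neg_sub, ← imPart_sub]
    exact hw (Fin.rev j)

omit he hs hes in
/-- An eventual tube membership along a real parameter meets any one-sided condition: from
`Φ α₀ ∈ 𝒯ʳₙ`, continuity of `Φ`, and a property `P` holding for `α` in a punctured one-sided
neighbourhood of `α₀`, get `α` with both. [folklore] -/
theorem exists_param_mem_relForwardTube {Φ : ℝ → Fin n → Fin (d + 1) → ℂ} (hΦ : Continuous Φ) {α₀ : ℝ}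
    (h₀ : Φ α₀ ∈ QuantumFieldTheory.relForwardTube d n) {P : ℝ → Prop} {l : Filter ℝ} [l.NeBot]
    (hl : l ≤ 𝓝 α₀) (hP : ∀ᶠ α in l, P α) :
    ∃ α, P α ∧ Φ α ∈ QuantumFieldTheory.relForwardTube d n := by
  have hev : ∀ᶠ α in 𝓝 α₀, Φ α ∈ QuantumFieldTheory.relForwardTube d n :=
    hΦ.continuousAt.eventually (isOpen_relForwardTube.mem_nhds h₀)
  exact (hP.and (hev.filter_mono hl)).exists

include heV in
/-- **Anchor for the reversal.** For `w ∈ 𝒯ʳₙ` there is `M' ∈ L₊(ℂ)` (an imaginary boost `B_{iα}`,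
`α` slightly below `π`) with `M'(w ∘ rev) ∈ 𝒯ʳₙ` and `Im (M' s) ∈ V₊`. [folklore] -/
theorem exists_anchor_rev {w : Fin n → Fin (d + 1) → ℂ} (hw : w ∈ QuantumFieldTheory.relForwardTube d n) :
    ∃ M' ∈ properComplexLorentzGroup d,
      (fun k => M' (w (Fin.revPerm k))) ∈ QuantumFieldTheory.relForwardTube d n ∧
      ∃ r : SpaceTime d, imPart (M' (complexifyPoint r)) ∈ forwardCone d := by
  -- `α` slightly below `π`: `sin α > 0` and `B_{iα}(w ∘ rev)` still in the tube
  have hP : ∀ᶠ α in 𝓝[<] Real.pi, 0 < Real.sin α := by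
    filter_upwards [Ioo_mem_nhdsLT Real.pi_pos] with α hα
    exact Real.sin_pos_of_pos_of_lt_pi hα.1 hα.2
  obtain ⟨α, hα, hmem⟩ := exists_param_mem_relForwardTube
    (continuous_planeBoost_config e s fun k => w (Fin.rev k))
    (planeBoost_pi_rev_mem_relForwardTube heV he hs hes hw) nhdsWithin_le_nhds hP
  refine ⟨planeBoostEquiv he hs hes ((α : ℂ) * I),
    planeBoostEquiv_mem_properComplexLorentzGroup he hs hes _, ?_, s, ?_⟩
  · simpa [Fin.revPerm_apply] using hmem
  · rw [planeBoostEquiv_apply]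
    exact imPart_planeBoost_frame_mem_forwardCone heV hs hes hα

end Frame

/-! ### The standard frame `(e₀, e₁)` in space dimension `d ≥ 1` -/

section StdFrame

variable {m : ℕ}

/-- `η(e₁, e₁) = −1` for the first spatial unit vector `e₁` of `ℝ^{1+(m+1)}`. [folklore] -/
theorem minkowskiForm_e₁_e₁ :
    minkowskiForm (m + 1) (EuclideanSpace.single 1 1) (EuclideanSpace.single 1 1) = -1 := by
  rw [minkowskiForm_apply, Fin.sum_univ_succ]
  simp [Fin.ext_iff]

/-- `η(e₀, e₁) = 0`. [folklore] -/
theorem minkowskiForm_e₀_e₁ :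
    minkowskiForm (m + 1) (e₀ (m + 1)) (EuclideanSpace.single 1 1) = 0 := by
  rw [minkowskiForm_e₀_left]
  simp

end StdFrame

/-! ### A space-like real vector in the real kernel of `Im M` -/

section Spacelike

variable {M : (Fin (d + 1) → ℂ) ≃ₗ[ℂ] (Fin (d + 1) → ℂ)}

/-- If `M ∈ L(ℂ)` maps the real vector `v` to a real vector, that vector is `Re (M v)` and has the
same Minkowski square as `v`. [folklore] -/
theorem minkowskiForm_rePart_eq (hM : M ∈ complexLorentzGroup d) {v : SpaceTime d}
    (hv : imPart (M (complexifyPoint v)) = 0) :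
    minkowskiForm d (rePart (M (complexifyPoint v))) (rePart (M (complexifyPoint v))) = minkowskiForm d v v := by
  have h := hM (complexifyPoint v) (complexifyPoint v)
  rw [eq_complexifyPoint_rePart hv, complexMinkowskiForm_complexifyPoint,
    complexMinkowskiForm_complexifyPoint] at h
  exact_mod_cast h

/-- **The key identity**: if `M ∈ L(ℂ)` maps the real `v` to the real `a`, then
`η(a, Im (M ζ)) = η(v, Im ζ)` for every complex `ζ` (imaginary part of `η_ℂ(M v, M ζ) = η_ℂ(v, ζ)`).
[folklore] -/
theorem minkowskiForm_rePart_imPart_apply (hM : M ∈ complexLorentzGroup d) {v : SpaceTime d}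
    (hv : imPart (M (complexifyPoint v)) = 0) (ζ : Fin (d + 1) → ℂ) :
    minkowskiForm d (rePart (M (complexifyPoint v))) (imPart (M ζ)) = minkowskiForm d v (imPart ζ) := by
  have h := congrArg Complex.im (hM (complexifyPoint v) ζ)
  rw [eq_complexifyPoint_rePart hv, im_complexMinkowskiForm_complexifyPoint,
    im_complexMinkowskiForm_complexifyPoint] at h
  exact h

/-- **The unit space-like vector `â = (0, a⃗/‖a⃗‖)`** of a vector with non-zero spatial part:
`â⁰ = 0`, `η(â, â) = −1`, `η(e₀, â) = 0`, `η(â, a) = −‖a⃗‖`. [folklore] -/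
theorem exists_spatialUnit {a : SpaceTime d} (ha : spaceC d a ≠ 0) :
    ∃ s : SpaceTime d, s 0 = 0 ∧ minkowskiForm d s s = -1 ∧ minkowskiForm d (e₀ d) s = 0 ∧
      minkowskiForm d s a = -‖spaceC d a‖ := by
  set s : SpaceTime d := ofTimeSpace 0 (‖spaceC d a‖⁻¹ • spaceC d a) with hsdef
  have hs0 : s 0 = 0 := ofTimeSpace_apply_zero _ _
  have hsp : spaceC d s = ‖spaceC d a‖⁻¹ • spaceC d a := spaceC_ofTimeSpace _ _
  have hn : ‖spaceC d a‖ ≠ 0 := norm_ne_zero_iff.2 ha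
  refine ⟨s, hs0, ?_, ?_, ?_⟩
  · rw [minkowskiForm_self, hs0, hsp, norm_smul, norm_inv, norm_norm, inv_mul_cancel₀ hn]
    ring
  · rw [minkowskiForm_e₀_left, hs0]
  · rw [minkowskiForm_eq_inner, hs0, hsp, real_inner_smul_left, real_inner_self_eq_norm_sq]
    field_simp
    ring

/-- **Anchor from a space-like vector in the real kernel.** If `M ∈ L₊(ℂ)` maps `w ∘ σ` into `𝒯ʳₙ`
and maps some real space-like `v` to a real vector `a`, then a small imaginary boost `B_{iα}` in the
plane `(e₀, â)` composed with `M` still maps `w ∘ σ` into `𝒯ʳₙ` and has `Im (B_{iα} M v) ∈ V₊`.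
[folklore] -/
theorem exists_anchor_of_spacelike_ker (hM : M ∈ properComplexLorentzGroup d) {σ : Equiv.Perm (Fin n)}
    {w : Fin n → Fin (d + 1) → ℂ} (hMw : (fun k => M (w (σ k))) ∈ QuantumFieldTheory.relForwardTube d n)
    {v : SpaceTime d} (hvs : IsSpacelike v) (hv : imPart (M (complexifyPoint v)) = 0) :
    ∃ M' ∈ properComplexLorentzGroup d,
      (fun k => M' (w (σ k))) ∈ QuantumFieldTheory.relForwardTube d n ∧
      ∃ r : SpaceTime d, imPart (M' (complexifyPoint r)) ∈ forwardCone d := by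
  set a : SpaceTime d := rePart (M (complexifyPoint v)) with ha
  have hMa : M (complexifyPoint v) = complexifyPoint a := eq_complexifyPoint_rePart hv
  have has : IsSpacelike a := by
    unfold IsSpacelike
    rw [ha, minkowskiForm_rePart_eq ((mem_properComplexLorentzGroup_iff M).1 hM).1 hv]
    exact hvs
  have hlt : |a 0| < ‖spaceC d a‖ := by
    have h' := has
    unfold IsSpacelike at h'
    rw [minkowskiForm_self] at h'
    exact abs_lt_of_sq_lt_sq (by linarith) (norm_nonneg _)
  have hne : spaceC d a ≠ 0 := fun h => by
    rw [h, norm_zero] at hlt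
    exact not_lt.2 (abs_nonneg (a 0)) hlt
  have hnorm : 0 < ‖spaceC d a‖ := norm_pos_iff.2 hne
  -- the frame `(e₀, â)`
  obtain ⟨s, hs0, hs, hes, hsa⟩ := exists_spatialUnit hne
  have he : minkowskiForm d (e₀ d) (e₀ d) = 1 := minkowskiForm_e₀_e₀
  -- the vector `u = ‖a⃗‖ e₀ + a⁰ â ∈ V₊`
  set u : SpaceTime d := ‖spaceC d a‖ • e₀ d + a 0 • s with hu
  have huV : u ∈ forwardCone d := by
    rw [mem_forwardCone_iff]
    constructor
    · simp [hu, e₀_apply, hs0, hnorm]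
    · have hse : minkowskiForm d s (e₀ d) = 0 := by rw [minkowskiForm_comm, hes]
      have : minkowskiForm d u u = ‖spaceC d a‖ ^ 2 - a 0 ^ 2 := by
        simp only [hu, map_add, map_smul, _root_.add_apply, _root_.smul_apply, smul_eq_mul, he, hs,
          hes, hse]
        ring
      rw [this, sub_pos]
      exact sq_lt_sq' (abs_lt.1 hlt).1 (abs_lt.1 hlt).2
  -- the imaginary part of `B_{iα} a`
  have him : ∀ α : ℝ, imPart (planeBoost (e₀ d) s ((α : ℂ) * I) (complexifyPoint a)) = Real.sin α • u := by
    intro α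
    rw [imPart_planeBoost_complexifyPoint, hsa, minkowskiForm_e₀_left, hu, smul_add,
      smul_smul, smul_smul]
    congr 1
    rw [mul_neg, neg_neg]
  -- `α` slightly above `0`
  have hP : ∀ᶠ α in 𝓝[>] (0 : ℝ), 0 < Real.sin α := by
    filter_upwards [Ioo_mem_nhdsGT Real.pi_pos] with α hα
    exact Real.sin_pos_of_pos_of_lt_pi hα.1 hα.2
  have h₀ : (fun k => planeBoost (e₀ d) s (((0 : ℝ) : ℂ) * I) (M (w (σ k)))) ∈
      QuantumFieldTheory.relForwardTube d n := by
    simpa [planeBoost_zero] using hMw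
  obtain ⟨α, hα, hmem⟩ := exists_param_mem_relForwardTube
    (continuous_planeBoost_config (e₀ d) s fun k => M (w (σ k))) h₀ nhdsWithin_le_nhds hP
  refine ⟨planeBoostEquiv he hs hes ((α : ℂ) * I) * M,
    Subgroup.mul_mem _ (planeBoostEquiv_mem_properComplexLorentzGroup he hs hes _) hM, ?_, v, ?_⟩
  · simpa [LinearEquiv.mul_apply] using hmem
  · rw [LinearEquiv.mul_apply, planeBoostEquiv_apply, hMa, him]
    exact smul_mem_forwardCone huV hα

end Spacelike

/-! ### No space-like vector in the real kernel: the permutation is trivial or the reversal -/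

section Causal

variable {M : (Fin (d + 1) → ℂ) ≃ₗ[ℂ] (Fin (d + 1) → ℂ)}

/-- **The causal case.** Let `M ∈ L(ℂ)`, `w ∈ 𝒯ʳₙ` with `M(w ∘ σ) ∈ 𝒯ʳₙ`, and let `v₀ ≠ 0` be a real
vector of non-negative square mapped by `M` to a real vector. Then `σ = 1` or `σ = rev`: with
`a = M v₀` (real, causal, non-zero), `η(a, Im M ζ) = η(v₀, Im ζ)` makes `i ↦ η(v₀, Im w_i)` strictly
monotone along `σ` (the `Im M`-differences of `w ∘ σ` lie in `V₊` and pair with `a` with a fixed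
sign), while it is strictly monotone along `i` (the differences of `Im w` lie in `V₊`). [folklore] -/
theorem perm_eq_one_or_rev_of_causal_ker (hM : M ∈ complexLorentzGroup d) {σ : Equiv.Perm (Fin n)}
    {w : Fin n → Fin (d + 1) → ℂ} (hw : w ∈ QuantumFieldTheory.relForwardTube d n)
    (hMw : (fun k => M (w (σ k))) ∈ QuantumFieldTheory.relForwardTube d n)
    {v₀ : SpaceTime d} (hv₀ : v₀ ≠ 0) (hvv : 0 ≤ minkowskiForm d v₀ v₀)
    (hv : imPart (M (complexifyPoint v₀)) = 0) : σ = 1 ∨ σ = Fin.revPerm := by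
  cases n with
  | zero => exact Or.inl (Subsingleton.elim _ _)
  | succ m =>
    set a : SpaceTime d := rePart (M (complexifyPoint v₀)) with ha
    have hMa : M (complexifyPoint v₀) = complexifyPoint a := eq_complexifyPoint_rePart hv
    have haa : 0 ≤ minkowskiForm d a a := by rw [ha, minkowskiForm_rePart_eq hM hv]; exact hvv
    have hane : a ≠ 0 := by
      intro h0
      apply hv₀
      have h1 : complexifyPoint v₀ = 0 :=
        M.injective (by rw [hMa, h0, map_zero]; funext μ; simp)
      refine complexifyPoint_injective (h1.trans ?_)
      funext μ; simp
    have key := minkowskiForm_rePart_imPart_apply hM hv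
    -- the height function
    set h : Fin (m + 1) → ℝ := fun i => minkowskiForm d v₀ (imPart (w i)) with hh
    rw [mem_relForwardTube_succ_iff] at hw hMw
    -- monotone along `i`
    have hmono : StrictMono h ∨ StrictAnti h := by
      rcases sign_dichotomy_of_causal hv₀ hvv with hpos | hneg
      · left
        refine Fin.strictMono_iff_lt_succ.2 fun j => ?_
        have := hpos _ (hw j)
        rw [imPart_sub, map_sub] at this
        simpa [hh] using this
      · right
        refine Fin.strictAnti_iff_succ_lt.2 fun j => ?_
        have := hneg _ (hw j)
        rw [imPart_sub, map_sub] at this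
        simp only [hh]
        linarith
    -- monotone along `σ`
    have hdiff : ∀ j : Fin m, minkowskiForm d a (imPart (M (w (σ j.succ)) - M (w (σ j.castSucc)))) =
        h (σ j.succ) - h (σ j.castSucc) := by
      intro j
      rw [← map_sub, ha, key, imPart_sub, map_sub]
    have hmonoσ : StrictMono (h ∘ σ) ∨ StrictAnti (h ∘ σ) := by
      rcases sign_dichotomy_of_causal hane haa with hpos | hneg
      · left
        refine Fin.strictMono_iff_lt_succ.2 fun j => ?_
        have := hpos _ (hMw j)
        rw [hdiff] at this
        simpa using this
      · right
        refine Fin.strictAnti_iff_succ_lt.2 fun j => ?_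
        have := hneg _ (hMw j)
        rw [hdiff] at this
        simp only [Function.comp_apply]
        linarith
    exact perm_eq_one_or_rev hmono hmonoσ

end Causal

/-! ### The dichotomy -/

/-- **Real anchors for the permuted tube (main result).** In space dimension `d = m + 1 ≥ 1`: if
`σ ≠ 1`, `w ∈ 𝒯ʳₙ`, `M ∈ L₊(ℂ)` and `M(w ∘ σ) ∈ 𝒯ʳₙ`, then some `M' ∈ L₊(ℂ)` maps `w ∘ σ` into `𝒯ʳₙ`
and has a real vector `r` with `Im (M' r) ∈ V₊` (so that `M'` maps the real configurations
`(k r)_k` into `𝒯ʳₙ`). [folklore] -/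
theorem exists_anchor {m n : ℕ} {σ : Equiv.Perm (Fin n)} (hσ : σ ≠ 1)
    {w : Fin n → Fin (m + 1 + 1) → ℂ} (hw : w ∈ QuantumFieldTheory.relForwardTube (m + 1) n)
    {M : (Fin (m + 1 + 1) → ℂ) ≃ₗ[ℂ] (Fin (m + 1 + 1) → ℂ)} (hM : M ∈ properComplexLorentzGroup (m + 1))
    (hMw : (fun k => M (w (σ k))) ∈ QuantumFieldTheory.relForwardTube (m + 1) n) :
    ∃ M' ∈ properComplexLorentzGroup (m + 1),
      (fun k => M' (w (σ k))) ∈ QuantumFieldTheory.relForwardTube (m + 1) n ∧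
      ∃ r : SpaceTime (m + 1), imPart (M' (complexifyPoint r)) ∈ forwardCone (m + 1) := by
  have hML : M ∈ complexLorentzGroup (m + 1) := ((mem_properComplexLorentzGroup_iff M).1 hM).1
  have he₀ : e₀ (m + 1) ∈ forwardCone (m + 1) := by
    rw [mem_forwardCone_iff, minkowskiForm_e₀_e₀, e₀_apply]
    simp
  -- the reversal
  by_cases hρ : σ = Fin.revPerm
  · subst hρ
    exact exists_anchor_rev he₀ minkowskiForm_e₀_e₀ minkowskiForm_e₁_e₁ minkowskiForm_e₀_e₁ hw
  -- a space-like vector in the real kernel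
  by_cases hS : ∃ v : SpaceTime (m + 1), IsSpacelike v ∧ imPart (M (complexifyPoint v)) = 0
  · obtain ⟨v, hvs, hv⟩ := hS
    exact exists_anchor_of_spacelike_ker hM hMw hvs hv
  push Not at hS
  -- a non-zero (causal) vector in the real kernel is impossible
  by_cases hK : ∃ v₀ : SpaceTime (m + 1), v₀ ≠ 0 ∧ imPart (M (complexifyPoint v₀)) = 0
  · obtain ⟨v₀, hv₀, hv⟩ := hK
    have hvv : 0 ≤ minkowskiForm (m + 1) v₀ v₀ := not_lt.1 fun hlt => hS v₀ hlt hv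
    rcases perm_eq_one_or_rev_of_causal_ker hML hw hMw hv₀ hvv hv with h1 | h2
    · exact absurd h1 hσ
    · exact absurd h2 hρ
  push Not at hK
  -- the real kernel is trivial: the real-linear map `v ↦ Im (M v)` is onto
  let L : SpaceTime (m + 1) →ₗ[ℝ] SpaceTime (m + 1) :=
    { toFun := fun v => imPart (M (complexifyPoint v))
      map_add' := fun v v' => by rw [complexifyPoint_add, map_add, imPart_add]
      map_smul' := fun c v => by rw [complexifyPoint_smul, map_smul, imPart_real_smul]; rfl }
  have hL : ∀ v, L v = imPart (M (complexifyPoint v)) := fun v => rfl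
  have hinj : Function.Injective L := by
    refine (injective_iff_map_eq_zero _).2 fun v hv => ?_
    by_contra hne
    exact hK v hne (by rw [← hL, hv])
  obtain ⟨r, hr⟩ := (LinearMap.injective_iff_surjective.1 hinj) (e₀ (m + 1))
  refine ⟨M, hM, hMw, r, ?_⟩
  rw [← hL, hr]
  exact he₀

/-- The real configuration `(k r)_k` is mapped into `𝒯ʳₙ` by `M'` as soon as `Im (M' r) ∈ V₊`.
[folklore] -/
theorem smul_config_mem_relForwardTube {M' : (Fin (d + 1) → ℂ) ≃ₗ[ℂ] (Fin (d + 1) → ℂ)} {r : SpaceTime d}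
    (hr : imPart (M' (complexifyPoint r)) ∈ forwardCone d) :
    (fun k : Fin n => M' (complexifyPoint (((k : ℕ) : ℝ) • r))) ∈ QuantumFieldTheory.relForwardTube d n := by
  cases n with
  | zero => exact fun k => k.elim0
  | succ m =>
    rw [mem_relForwardTube_succ_iff]
    intro j
    have : M' (complexifyPoint ((((j.succ : Fin (m + 1)) : ℕ) : ℝ) • r)) -
        M' (complexifyPoint ((((j.castSucc : Fin (m + 1)) : ℕ) : ℝ) • r)) = M' (complexifyPoint r) := by
      have hsub : ∀ a b : SpaceTime d, complexifyPoint (a - b) = complexifyPoint a - complexifyPoint b :=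
        fun a b => by funext μ; simp
      rw [← map_sub, ← hsub, ← sub_smul]
      simp
    rw [this]
    exact hr

end PermAnchor

end Literature.MathematicalPhysics.QuantumLattice
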